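import Summits.FinalStateConjecture.FinalStateConjecture.Theorems.EIHFluxBalanceInertialRecessionStubEndgameClasses

/-!
# Route EIHFluxBalance — crux `InertialRecession`, line `sublinear-is-free-clean-window-charges`:
# cluster bricks for the general-`N` endgame (tracked cluster velocity, member sets along admissible windows,
# cluster charge increments)

Helper file for the crux `stmt-FinalStateConjecture-10166`
(`Summit.FinalStateConjecture.FinalStateConjecture.Theses.EIHFluxBalance.InertialRecession`), registered stub
`stub_pairwiseDichotomy` (lead reshape r7) of `Cruxes/InertialRecession/Lines/sublinear_is_free_clean_window_charges.lean`;
bricks (0)/(4) of the general-`N` roadmap (`Endgame_generalN_roadmap.md`, evidence on the item):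

* `norm_sub_weightedMean_le` — the TRACKED CLUSTER VELOCITY `V_A = (Σ_A Eⱼvⱼ)/(Σ_A Eⱼ)` is a convex combination of the member
  velocities, so the "wobble" `‖v_k − V_A‖` of a member is at most the velocity spread of the cluster;
* `mem_iff_of_admissible` — along a window path on which every centre is either well inside (`≤ (1−δ)R`) or well outside
  (`≥ (1+δ)R`), membership does not change (connectedness of `[t₁, t₂]`);
* `cluster_increment` — WINDOW LAW + IDENTIFICATION ⇒ the energy and momentum of the member set of an admissible 2-Lipschitz
  window path change by at most `C∫R^{-3/2} + ζ(t₁) + ζ(t₂)` (componentwise).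

References: L. D. Landau, E. M. Lifshitz, The Classical Theory of Fields, §96; D. Saari, Trans. AMS 156 (1971) 219–240.
-/

noncomputable section

set_option linter.dupNamespace false

open Filter Topology Set MeasureTheory intervalIntegral
open scoped Topology BigOperators

namespace Summit.FinalStateConjecture.FinalStateConjecture.Theorems.SublinearIsFree.Endgame

open Literature.Geometry.Lorentzian

/-! ### The tracked cluster velocity is a convex combination -/

/-- WOBBLE ≤ SPREAD. For positive weights `E j` on a finite set `A ∋ k` and vectors `u j`, the weighted mean
`V = (Σ_A E j • u j)/(Σ_A E j)` satisfies `‖u k − V‖ ≤ η` as soon as `‖u k − u l‖ ≤ η` for all `l ∈ A`. [folklore] -/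
theorem norm_sub_weightedMean_le {ι : Type*} (A : Finset ι) (E : ι → ℝ) (u : ι → E3) {k : ι} {η : ℝ}
    (hk : k ∈ A) (hE : ∀ j ∈ A, 0 < E j) (hη : ∀ l ∈ A, ‖u k - u l‖ ≤ η) :
    ‖u k - (∑ j ∈ A, E j)⁻¹ • ∑ j ∈ A, E j • u j‖ ≤ η := by
  have hW : 0 < ∑ j ∈ A, E j := Finset.sum_pos hE ⟨k, hk⟩
  -- `u k − V = W⁻¹ • Σ_A E j • (u k − u j)`
  have hrepr : u k - (∑ j ∈ A, E j)⁻¹ • ∑ j ∈ A, E j • u j =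
      (∑ j ∈ A, E j)⁻¹ • ∑ j ∈ A, E j • (u k - u j) := by
    have h1 : ∑ j ∈ A, E j • (u k - u j) = (∑ j ∈ A, E j) • u k - ∑ j ∈ A, E j • u j := by
      simp only [smul_sub, Finset.sum_sub_distrib, Finset.sum_smul]
    rw [h1, smul_sub, smul_smul, inv_mul_cancel₀ hW.ne', one_smul]
  rw [hrepr, norm_smul, norm_inv, Real.norm_eq_abs, abs_of_pos hW]
  calc (∑ j ∈ A, E j)⁻¹ * ‖∑ j ∈ A, E j • (u k - u j)‖
      ≤ (∑ j ∈ A, E j)⁻¹ * ∑ j ∈ A, E j * η := by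
        refine mul_le_mul_of_nonneg_left ((norm_sum_le _ _).trans (Finset.sum_le_sum fun j hj ↦ ?_))
          (inv_nonneg.mpr hW.le)
        rw [norm_smul, Real.norm_eq_abs, abs_of_pos (hE j hj)]
        exact mul_le_mul_of_nonneg_left (hη j hj) (hE j hj).le
    _ = η := by
        rw [← Finset.sum_mul, ← mul_assoc, inv_mul_cancel₀ hW.ne', one_mul]

/-- The same bound for the energy–momentum form used by the endgame: with `E j = M j γ(v j)` and momenta `E j • v j`,
`‖v k − Π_A/E_A‖ ≤ η` whenever all `‖v k − v l‖ ≤ η`, `l ∈ A`. [folklore] -/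
theorem norm_sub_clusterVelocity_le {N : ℕ} (A : Finset (Fin N)) (M : Fin N → ℝ) (w : Fin N → E3) {k : Fin N} {η : ℝ}
    (hk : k ∈ A) (hM : ∀ j, 0 < M j) (hw1 : ∀ j, ‖w j‖ < 1) (hη : ∀ l ∈ A, ‖w k - w l‖ ≤ η) :
    ‖w k - (∑ j ∈ A, M j * (√(1 - ‖w j‖ ^ 2))⁻¹)⁻¹ • ∑ j ∈ A, (M j * (√(1 - ‖w j‖ ^ 2))⁻¹) • w j‖ ≤ η :=
  norm_sub_weightedMean_le A (fun j ↦ M j * (√(1 - ‖w j‖ ^ 2))⁻¹) w hk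
    (fun j _ ↦ mul_pos (hM j) (lt_of_lt_of_le one_pos (one_le_inv_sqrt_one_sub_sq (hw1 j)))) hη

/-! ### Member sets are constant along admissible window paths -/

/-- Along a window path on `[t₁, t₂]` with continuous centre distance `f` and radius `R > 0`, if at every time the centre is
either inside `(1−δ)R` or outside `(1+δ)R` (`0 < δ`), then "inside" at `t₁` is equivalent to "inside" at `t₂`
(the inside set is clopen in the connected interval). [folklore] -/
theorem inside_iff_of_admissible {f R : ℝ → ℝ} {t₁ t₂ δ : ℝ} (h12 : t₁ ≤ t₂) (hδ : 0 < δ)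
    (hf : ContinuousOn f (Icc t₁ t₂)) (hR : ContinuousOn R (Icc t₁ t₂)) (hRpos : ∀ s ∈ Icc t₁ t₂, 0 < R s)
    (hadm : ∀ s ∈ Icc t₁ t₂, f s ≤ (1 - δ) * R s ∨ (1 + δ) * R s ≤ f s) :
    (f t₁ ≤ (1 - δ) * R t₁ ↔ f t₂ ≤ (1 - δ) * R t₂) := by
  -- the continuous function `g = f − R` is never in `(−δR, δR)`, hence has constant sign
  have hpre : IsPreconnected (Icc t₁ t₂) := isPreconnected_Icc
  have hg : ContinuousOn (fun s ↦ f s - R s) (Icc t₁ t₂) := hf.sub hR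
  have h1 : t₁ ∈ Icc t₁ t₂ := left_mem_Icc.mpr h12
  have h2 : t₂ ∈ Icc t₁ t₂ := right_mem_Icc.mpr h12
  -- if the signs at the endpoints differed, `g` would vanish somewhere, contradicting admissibility
  have key : ∀ a ∈ Icc t₁ t₂, ∀ b ∈ Icc t₁ t₂, f a ≤ (1 - δ) * R a → f b ≤ (1 - δ) * R b := by
    intro a ha b hb hain
    by_contra hbout
    have hbout' : (1 + δ) * R b ≤ f b := (hadm b hb).resolve_left hbout
    have hga : f a - R a < 0 := by nlinarith [hRpos a ha]
    have hgb : 0 < f b - R b := by nlinarith [hRpos b hb]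
    -- intermediate value on the preconnected set
    obtain ⟨c, hc, hgc⟩ : ∃ c ∈ Icc t₁ t₂, f c - R c = 0 := by
      have := hpre.intermediate_value₂ ha hb hg continuousOn_const (f := fun s ↦ f s - R s) (g := fun _ ↦ (0 : ℝ))
        hga.le hgb.le
      obtain ⟨c, hc, hcc⟩ := this
      exact ⟨c, hc, hcc⟩
    rcases hadm c hc with hin | hout
    · nlinarith [hRpos c hc]
    · nlinarith [hRpos c hc]
  exact ⟨key t₁ h1 t₂ h2, key t₂ h2 t₁ h1⟩

/-- MEMBERSHIP IS CONSTANT along an admissible window path: for a finite index set `A`, if `j ∈ A ↔ inside at t₁` then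
`j ∈ A ↔ inside at t₂`. [folklore] -/
theorem mem_iff_of_admissible {N : ℕ} {ξ : Fin N → ℝ → E3} {c : ℝ → E3} {R : ℝ → ℝ} {t₁ t₂ δ : ℝ}
    (h12 : t₁ ≤ t₂) (hδ : 0 < δ) (hξ : ∀ j, Continuous (ξ j)) (hc : ContinuousOn c (Icc t₁ t₂))
    (hR : ContinuousOn R (Icc t₁ t₂)) (hRpos : ∀ s ∈ Icc t₁ t₂, 0 < R s)
    (hadm : ∀ s ∈ Icc t₁ t₂, ∀ j, ‖ξ j s - c s‖ ≤ (1 - δ) * R s ∨ (1 + δ) * R s ≤ ‖ξ j s - c s‖)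
    {A : Finset (Fin N)} (hA : ∀ j, j ∈ A ↔ ‖ξ j t₁ - c t₁‖ ≤ (1 - δ) * R t₁) :
    ∀ j, j ∈ A ↔ ‖ξ j t₂ - c t₂‖ ≤ (1 - δ) * R t₂ := by
  intro j
  rw [hA j]
  exact inside_iff_of_admissible h12 hδ (((hξ j).continuousOn).sub hc).norm hR hRpos fun s hs ↦ hadm s hs j

/-! ### Cluster charge increments from the window law and the identification -/

/-- **CLUSTER INCREMENT.** Instances of the WINDOW LAW (constants `C`, valid after `T`) and of the IDENTIFICATION (error `ζ`,
valid after `T'`) for abstract charges `P` give: along an admissible 2-Lipschitz window path on `[t₁, t₂]` whose member set at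
both endpoints is `A`, the cluster energy `Σ_A Mⱼγⱼ` and momentum `Σ_A Mⱼγⱼvⱼ` change by at most `C∫R^{-3/2} + ζ(t₁) + ζ(t₂)`.
[folklore] -/
theorem cluster_increment {N : ℕ} (M : Fin N → ℝ) (ξ v : Fin N → ℝ → E3) (κ : ℝ) (P : ℝ → E3 → ℝ → Fin 4 → ℝ)
    (ρ : ℝ → ℝ) (δ C T T' : ℝ) (ζ : ℝ → ℝ)
    (hWL : ∀ (t₁ t₂ : ℝ) (c : ℝ → E3) (R : ℝ → ℝ), T ≤ t₁ → t₁ ≤ t₂ →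
      (∀ s ∈ Set.Icc t₁ t₂, ∀ s' ∈ Set.Icc t₁ t₂, ‖c s - c s'‖ ≤ 2 * |s - s'| ∧ |R s - R s'| ≤ 2 * |s - s'|) →
      (∀ s ∈ Set.Icc t₁ t₂, ρ s ≤ δ * R s ∧ ‖c s‖ + R s ≤ (κ + κ ^ 2) / 2 * s ∧
        ∀ j, ‖ξ j s - c s‖ ≤ (1 - δ) * R s ∨ (1 + δ) * R s ≤ ‖ξ j s - c s‖) →
      ∀ μ : Fin 4, |P t₂ (c t₂) (R t₂) μ - P t₁ (c t₁) (R t₁) μ| ≤ C * ∫ s in t₁..t₂, (R s ^ (3 / 2 : ℝ))⁻¹)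
    (hID : ∀ (t : ℝ) (c : E3) (R : ℝ) (A : Finset (Fin N)), T' ≤ t → ρ t ≤ δ * R → ‖c‖ + R ≤ (κ + κ ^ 2) / 2 * t →
      (∀ j, ‖ξ j t - c‖ ≤ (1 - δ) * R ∨ (1 + δ) * R ≤ ‖ξ j t - c‖) → (∀ j, j ∈ A ↔ ‖ξ j t - c‖ ≤ (1 - δ) * R) →
      |P t c R 0 - ∑ j ∈ A, M j * (√(1 - ‖v j t‖ ^ 2))⁻¹| ≤ ζ t ∧
      ∀ k : Fin 3, |P t c R k.succ - ∑ j ∈ A, M j * (√(1 - ‖v j t‖ ^ 2))⁻¹ * v j t k| ≤ ζ t)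
    {t₁ t₂ : ℝ} {c : ℝ → E3} {R : ℝ → ℝ} {A : Finset (Fin N)} (hT : T ≤ t₁) (hT' : T' ≤ t₁) (h12 : t₁ ≤ t₂)
    (hlip : ∀ s ∈ Set.Icc t₁ t₂, ∀ s' ∈ Set.Icc t₁ t₂, ‖c s - c s'‖ ≤ 2 * |s - s'| ∧ |R s - R s'| ≤ 2 * |s - s'|)
    (hadm : ∀ s ∈ Set.Icc t₁ t₂, ρ s ≤ δ * R s ∧ ‖c s‖ + R s ≤ (κ + κ ^ 2) / 2 * s ∧
        ∀ j, ‖ξ j s - c s‖ ≤ (1 - δ) * R s ∨ (1 + δ) * R s ≤ ‖ξ j s - c s‖)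
    (hA₁ : ∀ j, j ∈ A ↔ ‖ξ j t₁ - c t₁‖ ≤ (1 - δ) * R t₁) (hA₂ : ∀ j, j ∈ A ↔ ‖ξ j t₂ - c t₂‖ ≤ (1 - δ) * R t₂) :
    |∑ j ∈ A, M j * (√(1 - ‖v j t₂‖ ^ 2))⁻¹ - ∑ j ∈ A, M j * (√(1 - ‖v j t₁‖ ^ 2))⁻¹| ≤
        C * (∫ s in t₁..t₂, (R s ^ (3 / 2 : ℝ))⁻¹) + ζ t₁ + ζ t₂ ∧
    ∀ k : Fin 3, |∑ j ∈ A, M j * (√(1 - ‖v j t₂‖ ^ 2))⁻¹ * v j t₂ k - ∑ j ∈ A, M j * (√(1 - ‖v j t₁‖ ^ 2))⁻¹ * v j t₁ k| ≤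
        C * (∫ s in t₁..t₂, (R s ^ (3 / 2 : ℝ))⁻¹) + ζ t₁ + ζ t₂ := by
  have h1 : t₁ ∈ Set.Icc t₁ t₂ := Set.left_mem_Icc.mpr h12
  have h2 : t₂ ∈ Set.Icc t₁ t₂ := Set.right_mem_Icc.mpr h12
  have hW := hWL t₁ t₂ c R hT h12 hlip hadm
  have hI₁ := hID t₁ (c t₁) (R t₁) A hT' (hadm t₁ h1).1 (hadm t₁ h1).2.1 (hadm t₁ h1).2.2 hA₁
  have hI₂ := hID t₂ (c t₂) (R t₂) A (hT'.trans h12) (hadm t₂ h2).1 (hadm t₂ h2).2.1 (hadm t₂ h2).2.2 hA₂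
  constructor
  · have hw := hW 0
    have ha := hI₁.1
    have hb := hI₂.1
    rw [abs_le] at hw ha hb ⊢
    constructor <;> linarith
  · intro k
    have hw := hW k.succ
    have ha := hI₁.2 k
    have hb := hI₂.2 k
    rw [abs_le] at hw ha hb ⊢
    constructor <;> linarith

/-- Registered helper form of `norm_sub_weightedMean_le` (wobble ≤ spread for the tracked cluster velocity). [folklore] -/
theorem endgame_norm_sub_clusterVelocity_le : open Literature.Geometry.Lorentzian in ∀ (N : ℕ) (A : Finset (Fin N)) (M : Fin N → ℝ) (w : Fin N → E3) (k : Fin N) (η : ℝ), k ∈ A → (∀ j, 0 < M j) → (∀ j, ‖w j‖ < 1) → (∀ l ∈ A, ‖w k - w l‖ ≤ η) → ‖w k - (∑ j ∈ A, M j * (√(1 - ‖w j‖ ^ 2))⁻¹)⁻¹ • ∑ j ∈ A, (M j * (√(1 - ‖w j‖ ^ 2))⁻¹) • w j‖ ≤ η :=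
  fun _ A M w _ _ hk hM hw1 hη ↦ norm_sub_clusterVelocity_le A M w hk hM hw1 hη

end Summit.FinalStateConjecture.FinalStateConjecture.Theorems.SublinearIsFree.Endgame

end
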